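import Summits.AnomalousDissipation.AnomalousDissipation.Theorems.KolmogorovFloor.Negative.TwoModes

/-!
# The axis-carrier beat (negative side of `KolmogorovFloor`, stmt-AnomalousDissipation-14030)

cdisprove seat `refuter-cdisprove-stmt-AnomalousDissipation-14030-0` (2026-08-16). The landed frame
(`Negative/Frame.lean :: frame_selection`, `wave_frequencies`) sends the two unresolved waves along an integer
direction `r ⊥ q` that can be as long as `|q|²`, so the carriers only satisfy `|p| ≤ N² + 2N + 5` and the viscous
price of the beat is `O(ν N⁴ α²)` — too expensive above resolution exponent `4/11`. This file formalises the
AXIS CARRIER of the paper attacks (QUIET-POINT-BEAT §2, ONE-STAGE-PHANTOM §3): carriers `p = m eᵢ − q`,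
`p + q = m eᵢ` (`m = 3N + 1`, so `N < |p|, |p+q| ≤ 4N + 1`), polarisations `z_A ∝ |p|²q − (q·p)p ⊥ p` and
`z_B ∝ eᵢ × q ⊥ p + q, q`, with the axis `i` chosen so that `3‖⟪Ĝ(q), eᵢ × q⟫‖² ≥ |q|²‖Ĝ(q)‖²` (Lagrange's
identity on `q^⊥`). The beat then has gain `≥ (9/10) α² ‖Ĝ(q)‖` at price `O((1+2Θ) ν N² α²)`: the input of
`Negative/BelowTaylor.lean` (every floor class with `N ≤ Cν^{-β}`, `β < 1/2`, is dead).
-/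

noncomputable section

open MeasureTheory UnitAddTorus Matrix
open scoped InnerProductSpace ENNReal ComplexConjugate

namespace Summit.AnomalousDissipation.AnomalousDissipation.Theorems.KolmogorovFloor.Negative

open Literature.Analysis.FunctionSpaces Literature.Analysis.FluidPDE
open Summit.AnomalousDissipation.AnomalousDissipation.Theorems.TaylorCertificatePair.Negative

/-! ### Axis selection: Lagrange's identity on `q^⊥` -/

/-- The three axis cross products `eᵢ × q`. -/
theorem axisCross_apply (q : Fin 3 → ℤ) (i : Fin 3) :
    (![![0, -(q 2), q 1], ![q 2, 0, -(q 0)], ![-(q 1), q 0, 0]] : Fin 3 → (Fin 3 → ℤ)) i =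
      (Pi.single i (1 : ℤ)) ⨯₃ q := by
  fin_cases i <;>
  · ext j
    fin_cases j <;> simp [cross_apply]

/-- `eᵢ × q ⊥ q`. -/
theorem axisCross_dot (q : Fin 3 → ℤ) (i : Fin 3) :
    (![![0, -(q 2), q 1], ![q 2, 0, -(q 0)], ![-(q 1), q 0, 0]] : Fin 3 → (Fin 3 → ℤ)) i ⬝ᵥ q = 0 := by
  fin_cases i <;> simp [dotProduct, Fin.sum_univ_three] <;> ring

/-- `(eᵢ × q)ᵢ = 0`. -/
theorem axisCross_self (q : Fin 3 → ℤ) (i : Fin 3) :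
    (![![0, -(q 2), q 1], ![q 2, 0, -(q 0)], ![-(q 1), q 0, 0]] : Fin 3 → (Fin 3 → ℤ)) i i = 0 := by
  fin_cases i <;> simp

/-- Lagrange's identity: for a real `w ⊥ q`, `∑ᵢ (w · (eᵢ × q))² = |q|² |w|²`. -/
theorem sum_sq_dot_axisCross (q : Fin 3 → ℤ) (w : Fin 3 → ℝ) (hw : w ⬝ᵥ (fun j => ((q) j : ℝ)) = 0) :
    ∑ i : Fin 3, (w ⬝ᵥ (fun j => (((![![0, -(q 2), q 1], ![q 2, 0, -(q 0)], ![-(q 1), q 0, 0]] : Fin 3 → (Fin 3 → ℤ)) i) j : ℝ))) ^ 2 =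
      Torus.freqNormSq q * (w ⬝ᵥ w) := by
  simp only [dotProduct, Fin.sum_univ_three] at hw ⊢
  simp only [Torus.freqNormSq, Fin.sum_univ_three, Matrix.cons_val_zero, Matrix.cons_val_one,
    Matrix.cons_val_two, Matrix.head_cons, Matrix.tail_cons, Int.cast_neg, Int.cast_zero]
  linear_combination (-(w 0 * (q 0 : ℝ) + w 1 * (q 1 : ℝ) + w 2 * (q 2 : ℝ))) * hw

/-- **Axis selection.** For `q ≠ 0` and a non-zero complex vector `g ⊥ q` one of the three axis cross products
`c = eᵢ × q` (a non-zero integer vector `⊥ q` with `cᵢ = 0`) captures a third of `|q|² ‖g‖²`: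
`|q|² ‖g‖² ≤ 3 ‖⟪g, c⟫‖²`. -/
theorem axis_selection {q : Fin 3 → ℤ} (g : (EuclideanSpace ℂ (Fin 3))) (hg0 : g ≠ 0)
    (hg : ((fun j => ((q) j : ℂ)) ⬝ᵥ (WithLp.ofLp (g))) = 0) (hq : q ≠ 0) :
    ∃ i : Fin 3,
      (![![0, -(q 2), q 1], ![q 2, 0, -(q 0)], ![-(q 1), q 0, 0]] : Fin 3 → (Fin 3 → ℤ)) i ≠ 0 ∧
      Torus.freqNormSq q * ‖g‖ ^ 2 ≤
        3 * ‖⟪g, EuclideanSpace.complexify (WithLp.toLp 2 (fun j => (((![![0, -(q 2), q 1], ![q 2, 0, -(q 0)], ![-(q 1), q 0, 0]] : Fin 3 → (Fin 3 → ℤ)) i) j : ℝ)))⟫_ℂ‖ ^ 2 := by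
  set C : Fin 3 → (Fin 3 → ℤ) := ![![0, -(q 2), q 1], ![q 2, 0, -(q 0)], ![-(q 1), q 0, 0]] with hC
  set gR : Fin 3 → ℝ := fun j => (g j).re with hgR
  set gI : Fin 3 → ℝ := fun j => (g j).im with hgI
  have hvR : gR ⬝ᵥ (fun i => ((q) i : ℝ)) = 0 := by
    have h := congrArg Complex.re hg
    rw [re_dotc, Complex.zero_re] at h
    exact h
  have hvI : gI ⬝ᵥ (fun i => ((q) i : ℝ)) = 0 := by
    have h := congrArg Complex.im hg
    rw [im_dotc, Complex.zero_im] at h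
    exact h
  -- the captured quantity of axis `i`
  have hT : ∀ i, ‖⟪g, EuclideanSpace.complexify (WithLp.toLp 2 (fun j => ((C i) j : ℝ)))⟫_ℂ‖ ^ 2 =
      (gR ⬝ᵥ (fun j => ((C i) j : ℝ))) ^ 2 + (gI ⬝ᵥ (fun j => ((C i) j : ℝ))) ^ 2 := by
    intro i
    rw [norm_sq_inner_complexify]
    rfl
  have hsum : ∑ i : Fin 3, ‖⟪g, EuclideanSpace.complexify (WithLp.toLp 2 (fun j => ((C i) j : ℝ)))⟫_ℂ‖ ^ 2 =
      Torus.freqNormSq q * ‖g‖ ^ 2 := by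
    simp_rw [hT]
    rw [Finset.sum_add_distrib, sum_sq_dot_axisCross q gR hvR, sum_sq_dot_axisCross q gI hvI, norm_sq_eq_dot g]
    ring
  -- some axis captures a third
  have hex : ∃ i : Fin 3, Torus.freqNormSq q * ‖g‖ ^ 2 ≤
      3 * ‖⟪g, EuclideanSpace.complexify (WithLp.toLp 2 (fun j => ((C i) j : ℝ)))⟫_ℂ‖ ^ 2 := by
    by_contra h
    push Not at h
    have h3 : ∑ i : Fin 3, 3 * ‖⟪g, EuclideanSpace.complexify (WithLp.toLp 2 (fun j => ((C i) j : ℝ)))⟫_ℂ‖ ^ 2 <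
        ∑ _i : Fin 3, Torus.freqNormSq q * ‖g‖ ^ 2 :=
      Finset.sum_lt_sum_of_nonempty Finset.univ_nonempty fun i _ => h i
    rw [← Finset.mul_sum, hsum, Finset.sum_const, Finset.card_univ, Fintype.card_fin] at h3
    simp at h3
  obtain ⟨i, hi⟩ := hex
  refine ⟨i, ?_, hi⟩
  intro hzero
  have hq1 : 1 ≤ Torus.freqNormSq q := Torus.one_le_freqNormSq_of_ne_zero hq
  have hgpos : 0 < ‖g‖ ^ 2 := by positivity
  have hz : ‖⟪g, EuclideanSpace.complexify (WithLp.toLp 2 (fun j => ((C i) j : ℝ)))⟫_ℂ‖ ^ 2 = 0 := by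
    have h0 : (WithLp.toLp 2 (fun j => ((C i) j : ℝ)) : EuclideanSpace ℝ (Fin 3)) = 0 := by
      ext j
      simp [hzero]
    rw [h0, map_zero, inner_zero_right, norm_zero]
    norm_num
  rw [hz] at hi
  nlinarith


/-! ### Axis carriers: `p = m eᵢ − q`, `p + q = m eᵢ`, `m = 3N + 1` -/

/-- `|m eᵢ − q|² = m² − 2 m qᵢ + |q|²`. -/
theorem freqNormSq_single_sub (i : Fin 3) (m : ℤ) (q : Fin 3 → ℤ) :
    Torus.freqNormSq (Pi.single i m - q) = (m : ℝ) ^ 2 - 2 * m * (q i) + Torus.freqNormSq q := by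
  fin_cases i <;> simp [Torus.freqNormSq, Fin.sum_univ_three, Pi.single_apply] <;> ring

/-- `|m eᵢ|² = m²`. -/
theorem freqNormSq_single (i : Fin 3) (m : ℤ) :
    Torus.freqNormSq (Pi.single i m : Fin 3 → ℤ) = (m : ℝ) ^ 2 := by
  fin_cases i <;> simp [Torus.freqNormSq, Pi.single_apply]

/-- `|(m eᵢ − q) + m eᵢ|² = 4m² − 4 m qᵢ + |q|²`. -/
theorem freqNormSq_single_sub_add_single (i : Fin 3) (m : ℤ) (q : Fin 3 → ℤ) :
    Torus.freqNormSq (Pi.single i m - q + Pi.single i m) = 4 * (m : ℝ) ^ 2 - 4 * m * (q i) + Torus.freqNormSq q := by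
  fin_cases i <;> simp [Torus.freqNormSq, Fin.sum_univ_three, Pi.single_apply] <;> ring

/-- A coordinate is bounded by the norm: `qᵢ² ≤ |q|²`. -/
theorem sq_apply_le_freqNormSq (q : Fin 3 → ℤ) (i : Fin 3) : ((q i : ℝ)) ^ 2 ≤ Torus.freqNormSq q := by
  fin_cases i <;> simp [Torus.freqNormSq, Fin.sum_univ_three] <;> nlinarith [sq_nonneg (q 0 : ℝ), sq_nonneg (q 1 : ℝ), sq_nonneg (q 2 : ℝ)]

/-- **Axis carriers.** For `|q| ≤ N` and any axis `i`, the frequencies `p = (3N+1)eᵢ − q` and `p + q = (3N+1)eᵢ`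
(and `p + (p+q)`) lie outside the ball of radius `N`, while `|p|, |p+q| ≤ 4N + 1`. -/
theorem axis_carriers (N : ℕ) {q : Fin 3 → ℤ} (hqN : Torus.freqNormSq q ≤ (N : ℝ) ^ 2) (i : Fin 3) :
    (N : ℝ) ^ 2 < Torus.freqNormSq (Pi.single i ((3 * N + 1 : ℕ) : ℤ) - q) ∧
    (N : ℝ) ^ 2 < Torus.freqNormSq (Pi.single i ((3 * N + 1 : ℕ) : ℤ) - q + q) ∧
    (N : ℝ) ^ 2 < Torus.freqNormSq (Pi.single i ((3 * N + 1 : ℕ) : ℤ) - q + (Pi.single i ((3 * N + 1 : ℕ) : ℤ) - q + q)) ∧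
    Torus.freqNormSq (Pi.single i ((3 * N + 1 : ℕ) : ℤ) - q) ≤ ((4 * N + 1 : ℕ) : ℝ) ^ 2 ∧
    Torus.freqNormSq (Pi.single i ((3 * N + 1 : ℕ) : ℤ) - q + q) ≤ ((4 * N + 1 : ℕ) : ℝ) ^ 2 := by
  have hq0 : 0 ≤ Torus.freqNormSq q := Torus.freqNormSq_nonneg q
  have hN0 : (0 : ℝ) ≤ N := Nat.cast_nonneg N
  have hqi : ((q i : ℝ)) ^ 2 ≤ (N : ℝ) ^ 2 := (sq_apply_le_freqNormSq q i).trans hqN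
  have hb := abs_le_of_sq_le_sq' hqi hN0
  have hqiN : (q i : ℝ) ≤ N := hb.2
  have hqiN' : -(N : ℝ) ≤ (q i : ℝ) := hb.1
  rw [sub_add_cancel, freqNormSq_single_sub, freqNormSq_single, freqNormSq_single_sub_add_single]
  have em : (((3 * N + 1 : ℕ) : ℤ) : ℝ) = 3 * N + 1 := by push_cast; ring
  have e4 : (((4 * N + 1 : ℕ)) : ℝ) = 4 * N + 1 := by push_cast; ring
  rw [em, e4]
  refine ⟨by nlinarith, by nlinarith, by nlinarith, by nlinarith, by nlinarith⟩


/-! ### Real arithmetic of the gain -/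

/-- `π² > 9.72`, from `π > 3.14`. -/
theorem pi_sq_gt : (972 : ℝ) / 100 < Real.pi ^ 2 := by
  have h : (3.14 : ℝ) ^ 2 < Real.pi ^ 2 := pow_lt_pow_left₀ Real.pi_gt_d2 (by norm_num) two_ne_zero
  norm_num at h
  linarith

/-- The gain of the axis beat: with `r = α D/‖v‖`, `‖v‖² = |p|² D`, `D = m² |c|²`, `|p|² ≤ 4m²`, `|c|² ≥ 1`,
`‖ζ‖² |c|² = T`, `|q|² ‖ĝ‖² ≤ 3T`, `|q|² ≥ 1`: `(9/10) α² ‖ĝ‖ ≤ π r α ‖ζ‖`. -/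
theorem axis_gain_bound {r ζn α gn cc pp D m T fq nv : ℝ} (hr : r = α * D / nv) (hnv2 : nv ^ 2 = pp * D)
    (hnv : 0 < nv) (hD : D = m ^ 2 * cc) (hcc : 1 ≤ cc) (hpp4 : pp ≤ 4 * m ^ 2) (hpp0 : 0 < pp)
    (hζ2 : ζn ^ 2 * cc = T) (hT : fq * gn ^ 2 ≤ 3 * T) (hfq : 1 ≤ fq) (hα : 0 ≤ α) (hgn : 0 ≤ gn)
    (hζn : 0 ≤ ζn) (hm : 0 < m) : 9 / 10 * α ^ 2 * gn ≤ Real.pi * r * α * ζn := by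
  have hcc0 : 0 < cc := by linarith
  have hD0 : 0 < D := by rw [hD]; positivity
  -- `r² = α² D / pp ≥ α² cc / 4`
  have hr2 : r ^ 2 * pp = α ^ 2 * D := by
    rw [hr, div_pow, mul_pow]
    have : nv ^ 2 ≠ 0 := by positivity
    field_simp
    rw [hnv2]
    ring
  have hr0 : 0 ≤ r := by rw [hr]; positivity
  have hr2' : α ^ 2 * cc ≤ 4 * r ^ 2 := by
    -- α² D = r² pp ≤ r² · 4m², and D = m² cc
    have h1 : α ^ 2 * (m ^ 2 * cc) ≤ r ^ 2 * (4 * m ^ 2) := by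
      rw [← hD, ← hr2]
      exact mul_le_mul_of_nonneg_left hpp4 (sq_nonneg r)
    have hm2 : 0 < m ^ 2 := by positivity
    nlinarith
  -- `ζn² cc ≥ gn²/3`
  have hζ2' : gn ^ 2 ≤ 3 * (ζn ^ 2 * cc) := by
    rw [hζ2]
    nlinarith [sq_nonneg gn]
  -- product of squares
  have hprod : α ^ 2 * gn ^ 2 ≤ 12 * (r ^ 2 * ζn ^ 2) := by
    -- (α² cc)(gn²) ≤ (4 r²)(3 ζn² cc) and cancel cc > 0
    have h := mul_le_mul hr2' hζ2' (sq_nonneg gn) (by positivity)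
    have e : 4 * r ^ 2 * (3 * (ζn ^ 2 * cc)) = (12 * (r ^ 2 * ζn ^ 2)) * cc := by ring
    have e' : α ^ 2 * cc * gn ^ 2 = (α ^ 2 * gn ^ 2) * cc := by ring
    rw [e, e'] at h
    exact le_of_mul_le_mul_right h hcc0
  -- take square roots through squares of nonnegative quantities
  have hsq : (9 / 10 * α ^ 2 * gn) ^ 2 ≤ (Real.pi * r * α * ζn) ^ 2 := by
    have hp := pi_sq_gt
    have e1 : (9 / 10 * α ^ 2 * gn) ^ 2 = 81 / 100 * α ^ 2 * (α ^ 2 * gn ^ 2) := by ring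
    have e2 : (Real.pi * r * α * ζn) ^ 2 = Real.pi ^ 2 * α ^ 2 * (r ^ 2 * ζn ^ 2) := by ring
    rw [e1, e2]
    have hα2 : 0 ≤ α ^ 2 := sq_nonneg α
    have hrz : 0 ≤ r ^ 2 * ζn ^ 2 := by positivity
    nlinarith [mul_le_mul_of_nonneg_left hprod hα2, mul_nonneg hα2 hrz]
  exact (pow_le_pow_iff_left₀ (by positivity) (by positivity) two_ne_zero).1 hsq

/-! ### Integer identities of the polarisation vector `v = |p|² q − (q·p) p` -/

/-- `v ⊥ p`. -/
theorem pol_dot_p (p q : Fin 3 → ℤ) : ((p ⬝ᵥ p) • q - (q ⬝ᵥ p) • p) ⬝ᵥ p = 0 := by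
  simp only [dotProduct, Fin.sum_univ_three, Pi.sub_apply, Pi.smul_apply, smul_eq_mul]
  ring

/-- `q · v = |p|²|q|² − (q·p)²`. -/
theorem q_dot_pol (p q : Fin 3 → ℤ) :
    q ⬝ᵥ ((p ⬝ᵥ p) • q - (q ⬝ᵥ p) • p) = (p ⬝ᵥ p) * (q ⬝ᵥ q) - (q ⬝ᵥ p) ^ 2 := by
  simp only [dotProduct, Fin.sum_univ_three, Pi.sub_apply, Pi.smul_apply, smul_eq_mul]
  ring

/-- `|v|² = |p|² (|p|²|q|² − (q·p)²)`. -/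
theorem pol_dot_pol (p q : Fin 3 → ℤ) :
    ((p ⬝ᵥ p) • q - (q ⬝ᵥ p) • p) ⬝ᵥ ((p ⬝ᵥ p) • q - (q ⬝ᵥ p) • p) =
      (p ⬝ᵥ p) * ((p ⬝ᵥ p) * (q ⬝ᵥ q) - (q ⬝ᵥ p) ^ 2) := by
  simp only [dotProduct, Fin.sum_univ_three, Pi.sub_apply, Pi.smul_apply, smul_eq_mul]
  ring

/-- Lagrange for the axis carrier: `|p|²|q|² − (q·p)² = m² |eᵢ × q|²` for `p = m eᵢ − q`. -/
theorem lagrange_axis (i : Fin 3) (m : ℤ) (q : Fin 3 → ℤ) :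
    ((Pi.single i m - q) ⬝ᵥ (Pi.single i m - q)) * (q ⬝ᵥ q) - (q ⬝ᵥ (Pi.single i m - q)) ^ 2 =
      m ^ 2 * ((![![0, -(q 2), q 1], ![q 2, 0, -(q 0)], ![-(q 1), q 0, 0]] : Fin 3 → (Fin 3 → ℤ)) i ⬝ᵥ
        (![![0, -(q 2), q 1], ![q 2, 0, -(q 0)], ![-(q 1), q 0, 0]] : Fin 3 → (Fin 3 → ℤ)) i) := by
  fin_cases i <;>
    simp [dotProduct, Fin.sum_univ_three, Pi.single_apply] <;> ring

/-- `(m eᵢ) · (eᵢ × q) = 0` (real casts). -/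
theorem single_dot_axisCross (i : Fin 3) (m : ℤ) (q : Fin 3 → ℤ) :
    (fun j => (((Pi.single i m : Fin 3 → ℤ)) j : ℝ)) ⬝ᵥ
      (fun j => ((((![![0, -(q 2), q 1], ![q 2, 0, -(q 0)], ![-(q 1), q 0, 0]] : Fin 3 → (Fin 3 → ℤ)) i)) j : ℝ)) = 0 := by
  fin_cases i <;> simp [dotProduct, Pi.single_apply]


/-! ### The axis beat: carriers, polarisations, value and gain -/

/-- **Axis beat data.** For a resolved frequency `q ≠ 0`, `|q| ≤ N`, and a non-zero transversal complex
vector `ĝ ⊥ q` (the largest resolved coefficient of the multiplier), and an amplitude `α ≥ 0`, there are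
carriers `p`, `p + q` outside the ball (`N < |p|, |p+q| ≤ 4N+1`, also `N < |2p+q|`) with transversal
polarisations `z_A ⊥ p`, `z_B ⊥ p + q`, `z_B ⊥ q` of norm `α` whose beat against `ĝ` at `q` is at most `-gain`
with `gain ≥ (9/10) α² ‖ĝ‖`. -/
theorem axis_beat_data {q : Fin 3 → ℤ} (hq0 : q ≠ 0) {N : ℕ} (hqN : Torus.freqNormSq q ≤ (N : ℝ) ^ 2)
    (g : (EuclideanSpace ℂ (Fin 3))) (hg0 : g ≠ 0) (hgq : ((fun j => ((q) j : ℂ)) ⬝ᵥ (WithLp.ofLp (g))) = 0)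
    {α : ℝ} (hα : 0 ≤ α) :
    ∃ (p : Fin 3 → ℤ) (zA zB : (EuclideanSpace ℂ (Fin 3))) (gain : ℝ),
      (N : ℝ) ^ 2 < Torus.freqNormSq p ∧ (N : ℝ) ^ 2 < Torus.freqNormSq (p + q) ∧
      (N : ℝ) ^ 2 < Torus.freqNormSq (p + (p + q)) ∧
      Torus.freqNormSq p ≤ ((4 * N + 1 : ℕ) : ℝ) ^ 2 ∧ Torus.freqNormSq (p + q) ≤ ((4 * N + 1 : ℕ) : ℝ) ^ 2 ∧
      ((fun j => ((p) j : ℂ)) ⬝ᵥ (WithLp.ofLp (zA))) = 0 ∧ ((fun j => (((p + q)) j : ℂ)) ⬝ᵥ (WithLp.ofLp (zB))) = 0 ∧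
      ((fun j => ((q) j : ℂ)) ⬝ᵥ (WithLp.ofLp (zB))) = 0 ∧ ‖zA‖ ≤ α ∧ ‖zB‖ ≤ α ∧
      Real.pi * (conj (((fun j => ((q) j : ℂ)) ⬝ᵥ (WithLp.ofLp (zA)))) * ⟪g, zB⟫_ℂ).im ≤ -gain ∧
      9 / 10 * α ^ 2 * ‖g‖ ≤ gain := by
  -- axis and its cross vector
  obtain ⟨i, hc0, hT⟩ := axis_selection g hg0 hgq hq0
  set c : Fin 3 → ℤ := (![![0, -(q 2), q 1], ![q 2, 0, -(q 0)], ![-(q 1), q 0, 0]] : Fin 3 → (Fin 3 → ℤ)) i with hcdef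
  have hcq : c ⬝ᵥ q = 0 := axisCross_dot q i
  set a : Fin 3 → ℝ := fun j => ((c j : ℝ)) with hadef
  have hcc1 : 1 ≤ Torus.freqNormSq c := Torus.one_le_freqNormSq_of_ne_zero hc0
  have haa : a ⬝ᵥ a = Torus.freqNormSq c := by rw [freqNormSq_eq_castR_dot]
  have ha2 : 0 < a ⬝ᵥ a := by rw [haa]; linarith
  obtain ⟨hB1, hBw⟩ := unit_along a ha2
  set B : (EuclideanSpace ℝ (Fin 3)) := (Real.sqrt (a ⬝ᵥ a))⁻¹ • (WithLp.toLp 2 a : (EuclideanSpace ℝ (Fin 3))) with hBdef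
  have hs0 : 0 < Real.sqrt (a ⬝ᵥ a) := Real.sqrt_pos.2 ha2
  -- the captured coefficient `ζ = ⟪ĝ, B⟫`
  set ζ : ℂ := ⟪g, EuclideanSpace.complexify B⟫_ℂ with hζdef
  have hζ : ζ = (((Real.sqrt (a ⬝ᵥ a))⁻¹ : ℝ) : ℂ) * ⟪g, EuclideanSpace.complexify (WithLp.toLp 2 a)⟫_ℂ := by
    rw [hζdef, hBdef, LinearIsometry.map_smul, ← Complex.coe_smul, inner_smul_right]
  have hζn : ‖ζ‖ ^ 2 * Torus.freqNormSq c = ‖⟪g, EuclideanSpace.complexify (WithLp.toLp 2 a)⟫_ℂ‖ ^ 2 := by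
    rw [hζ, norm_mul, Complex.norm_real, Real.norm_of_nonneg (inv_nonneg.2 hs0.le), mul_pow, inv_pow,
      Real.sq_sqrt ha2.le, haa]
    have : Torus.freqNormSq c ≠ 0 := by linarith
    field_simp
  have hζ0 : ζ ≠ 0 := by
    intro h
    rw [h, norm_zero] at hζn
    have hq1 : 1 ≤ Torus.freqNormSq q := Torus.one_le_freqNormSq_of_ne_zero hq0
    have hgp : 0 < ‖g‖ ^ 2 := by positivity
    have : ‖⟪g, EuclideanSpace.complexify (WithLp.toLp 2 a)⟫_ℂ‖ ^ 2 = 0 := by rw [← hζn]; ring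
    rw [hadef] at this
    rw [this] at hT
    nlinarith
  -- carriers
  set m : ℤ := ((3 * N + 1 : ℕ) : ℤ) with hmdef
  obtain ⟨hNp, hNpq, hN5, hLp, hLpq⟩ := axis_carriers N hqN i
  set p : Fin 3 → ℤ := Pi.single i m - q with hpdef
  have hpq : p + q = Pi.single i m := by rw [hpdef, sub_add_cancel]
  -- polarisation `z_B`
  set zB : (EuclideanSpace ℂ (Fin 3)) := (((-Complex.I * conj ((ζ)) * ((‖(ζ)‖⁻¹ : ℝ) : ℂ)) * ((α) : ℂ)) • EuclideanSpace.complexify (B)) with hzBdef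
  have hzBn : ‖zB‖ = α := norm_polB α hα hζ0 hB1
  have hdB : ((fun j => (((p + q)) j : ℂ)) ⬝ᵥ (WithLp.ofLp (zB))) = 0 := by
    rw [hzBdef, dotc_polB, hpq, hBw, single_dot_axisCross]
    simp
  have hBq : ((fun j => ((q) j : ℂ)) ⬝ᵥ (WithLp.ofLp (zB))) = 0 := by
    rw [hzBdef, dotc_polB, hBw]
    have : (fun j => ((q) j : ℝ)) ⬝ᵥ a = 0 := by
      rw [hadef, castR_dot, dotProduct_comm, hcq]; simp
    rw [this]; simp
  -- polarisation `z_A`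
  set v : Fin 3 → ℤ := (p ⬝ᵥ p) • q - (q ⬝ᵥ p) • p with hvdef
  set D : ℤ := (p ⬝ᵥ p) * (q ⬝ᵥ q) - (q ⬝ᵥ p) ^ 2 with hDdef
  have hDv : q ⬝ᵥ v = D := by rw [hvdef, hDdef]; exact q_dot_pol p q
  have hpv : p ⬝ᵥ v = 0 := by rw [hvdef, dotProduct_comm]; exact pol_dot_p p q
  have hvv : v ⬝ᵥ v = (p ⬝ᵥ p) * D := by rw [hvdef, hDdef]; exact pol_dot_pol p q
  have hDm : D = m ^ 2 * (c ⬝ᵥ c) := by rw [hDdef, hpdef, hcdef]; exact lagrange_axis i m q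
  have hcc : ((c ⬝ᵥ c : ℤ) : ℝ) = Torus.freqNormSq c := by rw [freqNormSq_eq_castR_dot, castR_dot]
  have hpp : ((p ⬝ᵥ p : ℤ) : ℝ) = Torus.freqNormSq p := by rw [freqNormSq_eq_castR_dot, castR_dot]
  have hp1 : 1 ≤ Torus.freqNormSq p := by
    have hp0 : p ≠ 0 := ne_zero_of_freqNormSq_pos (sq_nonneg _) hNp
    exact Torus.one_le_freqNormSq_of_ne_zero hp0
  have hm1 : (1 : ℝ) ≤ (m : ℝ) := by rw [hmdef]; push_cast; linarith [(Nat.cast_nonneg N : (0:ℝ) ≤ N)]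
  have hDpos : 0 < (D : ℝ) := by
    rw [hDm]; push_cast; rw [hcc]
    have : (1 : ℝ) ≤ (m : ℝ) ^ 2 := one_le_pow₀ hm1
    nlinarith
  set vL : (EuclideanSpace ℝ (Fin 3)) := WithLp.toLp 2 (fun j => ((v j : ℝ))) with hvLdef
  have hvL2 : ‖vL‖ ^ 2 = Torus.freqNormSq p * D := by
    rw [hvLdef, norm_sq_toLp, castR_dot, hvv]; push_cast; rw [hpp]
  have hvLpos : 0 < ‖vL‖ := by
    have h2 : 0 < ‖vL‖ ^ 2 := by rw [hvL2]; positivity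
    rcases (norm_nonneg vL).lt_or_eq with h | h
    · exact h
    · rw [← h] at h2; simp at h2
  set zA : (EuclideanSpace ℂ (Fin 3)) := (((α / ‖vL‖ : ℝ)) : ℂ) • EuclideanSpace.complexify vL with hzAdef
  have hzAn : ‖zA‖ = α := by
    rw [hzAdef, norm_smul, Complex.norm_real, Real.norm_of_nonneg (div_nonneg hα hvLpos.le),
      EuclideanSpace.norm_complexify, div_mul_cancel₀ _ hvLpos.ne']
  have hdotA : ∀ κ : Fin 3 → ℤ, ((fun j => ((κ) j : ℂ)) ⬝ᵥ (WithLp.ofLp (zA))) =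
      (((α / ‖vL‖ : ℝ)) : ℂ) * ((κ ⬝ᵥ v : ℤ) : ℂ) := by
    intro κ
    rw [hzAdef, dotc_smul, hvLdef, dotc_complexify_castR]
  have hdA : ((fun j => ((p) j : ℂ)) ⬝ᵥ (WithLp.ofLp (zA))) = 0 := by
    rw [hdotA, hpv]; simp
  have hqzA : ((fun j => ((q) j : ℂ)) ⬝ᵥ (WithLp.ofLp (zA))) = (((α / ‖vL‖ * D : ℝ)) : ℂ) := by
    rw [hdotA, hDv]; push_cast; ring
  -- the value of the beat
  set gain : ℝ := Real.pi * (α / ‖vL‖ * D) * α * ‖ζ‖ with hgaindef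
  have hinner : ⟪g, zB⟫_ℂ = (α : ℂ) * (-Complex.I * (‖ζ‖ : ℂ)) := by
    rw [hzBdef, inner_polB, ← hζdef]
    rw [show (-Complex.I * conj ζ * ((‖ζ‖⁻¹ : ℝ) : ℂ)) * (α : ℂ) * ζ =
        (α : ℂ) * ((-Complex.I * conj ζ * ((‖ζ‖⁻¹ : ℝ) : ℂ)) * ζ) by ring, phase_mul_self ζ hζ0]
  have hbeat : Real.pi * (conj (((fun j => ((q) j : ℂ)) ⬝ᵥ (WithLp.ofLp (zA)))) * ⟪g, zB⟫_ℂ).im ≤ -gain := by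
    rw [hqzA, hinner, Complex.conj_ofReal]
    have e : ((((α / ‖vL‖ * D : ℝ)) : ℂ) * ((α : ℂ) * (-Complex.I * (‖ζ‖ : ℂ)))).im =
        -(α / ‖vL‖ * D * α * ‖ζ‖) := by
      simp [Complex.mul_im, Complex.mul_re]
      ring
    rw [e, hgaindef]
    linarith
  -- the gain
  have hmR : (m : ℝ) = 3 * N + 1 := by rw [hmdef]; push_cast; ring
  have hgain : 9 / 10 * α ^ 2 * ‖g‖ ≤ gain := by
    have hT' : Torus.freqNormSq q * ‖g‖ ^ 2 ≤ 3 * ‖⟪g, EuclideanSpace.complexify (WithLp.toLp 2 a)⟫_ℂ‖ ^ 2 := hT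
    have hDR : (D : ℝ) = (m : ℝ) ^ 2 * Torus.freqNormSq c := by rw [hDm]; push_cast; rw [hcc]
    have hpp4 : Torus.freqNormSq p ≤ 4 * (m : ℝ) ^ 2 := by
      have e4 : (((4 * N + 1 : ℕ)) : ℝ) = 4 * N + 1 := by push_cast; ring
      rw [e4] at hLp
      rw [hmR]
      nlinarith [(Nat.cast_nonneg N : (0:ℝ) ≤ N)]
    have hpp0 : 0 < Torus.freqNormSq p := by linarith
    have hm0 : 0 < (m : ℝ) := by linarith
    rw [hgaindef]
    have e : Real.pi * (α / ‖vL‖ * ↑D) * α * ‖ζ‖ = Real.pi * (α * ↑D / ‖vL‖) * α * ‖ζ‖ := by ring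
    rw [e]
    exact axis_gain_bound (r := α * D / ‖vL‖) rfl hvL2 hvLpos hDR hcc1 hpp4 hpp0 hζn hT'
      (Torus.one_le_freqNormSq_of_ne_zero hq0) hα (norm_nonneg g) (norm_nonneg ζ) hm0
  exact ⟨p, zA, zB, gain, hNp, hNpq, hN5, hLp, hLpq, hdA, hdB, hBq, hzAn.le, hzBn.le, hbeat, hgain⟩

end Summit.AnomalousDissipation.AnomalousDissipation.Theorems.KolmogorovFloor.Negative
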